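import Mathlib.Analysis.Fourier.AddCircle
import Mathlib.Analysis.MellinTransform
import Mathlib.NumberTheory.LSeries.RiemannZeta
import Mathlib.Analysis.Distribution.SchwartzSpace.Basic
import Mathlib.Analysis.InnerProductSpace.Projection.Submodule
import Mathlib.Analysis.BoundedVariation
import Mathlib.MeasureTheory.Function.LpSpace.Basic
import Mathlib.MeasureTheory.Group.Measure
import Literature.NumberTheory.LFunctions.ConnesProlateGuess
import HarnessLib

/-!
# Connes–Consani, *Spectral triples and ζ-cycles*, §6: zeros of zeta and ζ-cycles

RH-FREE corpus literature (label, line 1): this section of Connes–Consani 2023 characterises the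
zeros of `ζ` ON the critical line by the non-density of a space of "scale-invariant Riemann sums" on a
circle; it asserts no positivity and nothing about zeros OFF the line.  Nothing in this file bears on
the truth of RH.  bears_on: W-C/W-P (cell rh-crit, corpus C1, sequel row t11; no leaf role).

Source: A. Connes, C. Consani, *Spectral triples and ζ-cycles*, Enseign. Math. 69 (2023) 93–148,
arXiv:2106.01715, **§6** [ConnesConsani2023].  Locators `pNNNN:Lnn` refer to chunk:line of the materialised
arXiv text (`lit read arxiv:2106.01715`).  Statements first (cell rh-crit playbook): every numbered
statement of §6 is typed with its locator; what is not proved in this file is a NAMED FACT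
`def CC2023_… : Prop` (D-0014), to be discharged top-down (Theorem 6.4 first) in sequel files.

## The objects (§6.1, p0018:L8–L20, L60; §6.2, p0019:L1–L5; p0020:L3)

* `scaleSum μ g u = Σ_{k ∈ ℤ} g(μ^k u)` — the scale-invariant sum `Σ_μ` (§6.1 eq. (Σ_μ g), p0018:L10).
* Connes' map `𝓔(f)(u) = u^{1/2} Σ_{n ≥ 1} f(n u)` is ALREADY in the tree as
  `Literature.NumberTheory.LFunctions.connesE` (Connes 2026 Letter §6.1 = this paper's (𝓔 f), p0018:L16):
  cited, not re-defined.
* `schwartzEv0` — the real linear space `𝒮^ev_0` of real-valued even Schwartz functions with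
  `f(0) = 0 = ∫ f` (p0018:L20), as a `Submodule ℝ 𝓢(ℝ, ℝ)`.
* the circle of length `L = log μ`: `C_μ = ℝ₊^*/μ^ℤ` (p0019:L1) is modelled ADDITIVELY, `u = eˣ`, as
  Mathlib's `AddCircle L` with its Haar probability measure `AddCircle.haarAddCircle` (the paper's measure
  `d^*u` has total mass `L`; density, orthogonality and spectra are insensitive to this normalisation).
  The function `Σ_μ 𝓔(f)` on the circle is `sigmaE L f : AddCircle L → ℂ`,
  `sigmaE L f ↑x = Σ_{k ∈ ℤ} 𝓔(f)(e^{kL} eˣ)` (`sigmaE_coe`).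
* `zetaCycleRange L` — the subspace `Σ_μ 𝓔(𝒮^ev_0) ⊂ L²(C)`: the `ℂ`-span, inside the complex Hilbert space
  `Lp ℂ 2 haarAddCircle`, of the classes a.e. equal to some `sigmaE L f`, `f ∈ 𝒮^ev_0`.  (The paper's
  subspace is real-linear and consists of real-valued functions; its density in real `L²(C)` and the
  density of its complex span in complex `L²(C)` are the same condition — both say that no non-zero
  `ξ` is orthogonal to every `Σ_μ 𝓔(f)` — and Theorem 6.4 needs the complex space to speak of the
  characters `u^{is}`.)
* `IsZetaCycle L` — **Definition 6.1** (= Def. 1.1): the circle of length `L` is a ζ-cycle iff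
  `Σ_μ 𝓔(𝒮^ev_0)` is NOT dense in `L²(C)` (p0019:L5; p0002:L20).
* `zetaCycleSpace L = (Σ_μ 𝓔(𝒮^ev_0))^⊥ = 𝓗(L)` (p0020:L3), and `isZetaCycle_iff_zetaCycleSpace_ne_bot`.
* `zetaCycleSpectrum L` — the spectrum of the action `ϑ` of `ℝ₊^*` on `𝓗(L)`.  The action is periodic,
  so it factors through the compact group `C_μ`; in `L²(C_μ)` every character `u ↦ u^{is}` (`μ^{is} = 1`,
  i.e. `sL ∈ 2πℤ`; additively `x ↦ e^{isx} = fourier n`, `s = 2πn/L`) occurs exactly once, so the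
  spectrum of `ϑ` on the closed invariant subspace `𝓗(L)` is the set of those `s` whose character
  belongs to `𝓗(L)` (proof of Thm 6.4 (i), p0019:L18).  We take this as the definition:
  `s ∈ zetaCycleSpectrum L ↔ ∃ n : ℤ, sL = 2πn ∧ fourierLp 2 n ∈ 𝓗(L)`.  Since the generators
  `Σ_μ 𝓔(f)` are real-valued, `𝓗(L)` is stable under complex conjugation and this set is symmetric
  under `s ↦ −s`; it therefore does not matter whether one attaches to `s` the eigenfunction `u^{is}`
  or `u^{-is}` of `ϑ` (the paper writes "contains `is`" in Thm 6.4 (ii) and "contains `s`" in Thm 1.1 (ii)).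
* the scaling action `(ϑ(λ)f)(x) = f(λ⁻¹x)` (p0018:L60): on functions `scaleAct`, on `𝓢(ℝ,ℝ)`
  `schwartzScale` (Mathlib `SchwartzMap.compCLMOfContinuousLinearEquiv` with the dilation
  `ContinuousLinearEquiv.smulLeft`, the same map as the tree's `Literature.Analysis.Distribution.invDilation`),
  on `L²(C)` the rotation `rotateLp L a`, `a = log λ`.

## The statements

PROVED here: periodicity of `Σ_μ 𝓔(f) ∘ exp` (`sigmaE` is well defined), the algebraic part of
**Lemma 6.2 (i)** (`schwartzScale_mem_schwartzEv0` — `𝒮^ev_0` is scale invariant —, `connesE_scaleAct`,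
`scaleSum_scaleAct`, and the display (ϑ Σ_μ 𝓔), `sigmaE_schwartzScale`), and
`isZetaCycle_iff_zetaCycleSpace_ne_bot`.

NAMED FACTS (to be discharged; all RH-FREE): `CC2023_lemma_6_1` (Lemma 6.1, p0018:L23),
`CC2023_lemma_6_2_ii`, `CC2023_lemma_6_2_iii` (p0018:L69), `CC2023_prop_6_3` (stability under finite
covers, p0019:L9), `CC2023_mapEzeta` (eq. (𝓔 ζ) of the proof of Thm 6.4, p0019:L68: the Mellin
transform of `𝓔(f)` is `ζ(½ + s)` times that of `f`, across the critical line), `CC2023_gaussWitness_mem`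
and `CC2023_mellin_gaussWitness` (the test function of the proof of Thm 6.4 (i), p0019:L30–L44),
**`CC2023_thm_6_4_i`, `CC2023_thm_6_4_ii`** (Theorem 6.4 = Theorem 1.1, p0019:L16, p0002:L25) and
`CC2023_cor_6_5` (p0020:L5–L9).  Discharge route (recorded for the prover): Lemma 6.1 for Schwartz data
by the Riemann-sum estimate; `CC2023_mapEzeta` from the tree's Müntz continuation
`Literature.NumberTheory.LFunctions.mellin_tsum_comp_mul_nat_of_isBigO` (with `b = 0`) and
`mellin_connesE`; unfolding `⟨fourier n, Σ_μ 𝓔 f⟩ = L⁻¹ ∫_0^∞ u^{∓is} 𝓔(f)(u) d^*u`; Thm 6.4 from these.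

WHAT THIS IS NOT: no positivity statement, no claim about zeros off the critical line, no claim
about RH; `ζ(½) ≠ 0` is NOT used or asserted (Cor. 6.5 is typed exactly as printed, with `s ∈ Z`
unrestricted in sign).  The numerical §§4–5 of the paper (spectral triples `Θ(λ,k)`) are rows t9/t10.
-/

noncomputable section

open scoped Topology SchwartzMap ENNReal
open Filter Asymptotics MeasureTheory Complex Set AddCircle
open Literature.NumberTheory.LFunctions (connesE)

namespace Literature.NumberTheory.ConnesConsani2023.ZetaCycles

/-! ### §6.1  Scale-invariant Riemann sums: `Σ_μ`, `𝓔`, `𝒮^ev_0` -/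

/-- The scale-invariant sum `(Σ_μ g)(u) := Σ_{k ∈ ℤ} g(μ^k u)` (Connes–Consani 2023, §6.1, display
(Σ_μ g), p0018:L10): "makes sense pointwise provided `g` decays fast enough at `0` and `∞`"; for a
non-summable family Mathlib's `tsum` junk value `0` is returned.
[cite: ConnesConsani2023, §6.1 eq. (Σ_μ g)(u) = Σ_{k∈ℤ} g(μ^k u) (arXiv chunk p0018:L10)] -/
def scaleSum {E : Type*} [AddCommMonoid E] [TopologicalSpace E] (μ : ℝ) (g : ℝ → E) (u : ℝ) : E :=
  ∑' k : ℤ, g (μ ^ k * u)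

/-- `Σ_μ` is `μ`-scale invariant: `(Σ_μ g)(μ u) = (Σ_μ g)(u)` (re-index `k ↦ k + 1`; `μ ≠ 0`).
[cite: ConnesConsani2023, §6.1 (arXiv chunk p0018:L10)] -/
theorem scaleSum_mul_self {E : Type*} [AddCommMonoid E] [TopologicalSpace E] {μ : ℝ} (hμ : μ ≠ 0)
    (g : ℝ → E) (u : ℝ) : scaleSum μ g (μ * u) = scaleSum μ g u := by
  unfold scaleSum
  have h : (fun k : ℤ => g (μ ^ k * (μ * u))) = fun k : ℤ => (fun j : ℤ => g (μ ^ j * u)) (k + 1) := by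
    funext k
    simp only [zpow_add_one₀ hμ, mul_assoc]
  rw [h]
  exact (Equiv.addRight (1 : ℤ)).tsum_eq (fun j : ℤ => g (μ ^ j * u))

/-- The scaling action of `ℝ₊^*` on functions, `(ϑ(λ) f)(x) := f(λ⁻¹ x)` (Connes–Consani 2023, §6.1,
p0018:L60). [cite: ConnesConsani2023, §6.1 (arXiv chunk p0018:L60)] -/
def scaleAct {E : Type*} (lam : ℝ) (g : ℝ → E) (x : ℝ) : E :=
  g (lam⁻¹ * x)

/-- `ϑ(λ) Σ_μ = Σ_μ ϑ(λ)` (Lemma 6.2 (i), second identity of display (ϑ Σ_μ), p0018:L66):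
pointwise `Σ_k g(λ⁻¹ μ^k u) = (Σ_μ g)(λ⁻¹ u)`. [cite: ConnesConsani2023, Lemma 6.2 (i) (arXiv chunk p0018:L66)] -/
theorem scaleSum_scaleAct {E : Type*} [AddCommMonoid E] [TopologicalSpace E] (μ lam : ℝ) (g : ℝ → E)
    (u : ℝ) : scaleSum μ (scaleAct lam g) u = scaleAct lam (scaleSum μ g) u := by
  simp only [scaleSum, scaleAct, mul_left_comm]

/-- `𝓔(ϑ(λ) f)(u) = λ^{1/2} (ϑ(λ) 𝓔(f))(u)`, i.e. `𝓔 ∘ λ^{-1/2} ϑ(λ) = ϑ(λ) ∘ 𝓔` (Lemma 6.2 (i), first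
identity of display (ϑ Σ_μ), p0018:L66, and its proof p0018:L74), for `λ > 0` and every real `u`
(both sides vanish for `u ≤ 0` by `Real.sqrt`'s junk value).  `𝓔` is the tree's `connesE`.
[cite: ConnesConsani2023, Lemma 6.2 (i) (arXiv chunk p0018:L74)] -/
theorem connesE_scaleAct {lam : ℝ} (hlam : 0 < lam) (f : ℝ → ℝ) (u : ℝ) :
    connesE (scaleAct lam f) u = Real.sqrt lam * scaleAct lam (connesE f) u := by
  simp only [connesE, scaleAct]
  have hs : Real.sqrt (lam⁻¹ * u) = (Real.sqrt lam)⁻¹ * Real.sqrt u := by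
    rw [Real.sqrt_mul (inv_nonneg.2 hlam.le), Real.sqrt_inv]
  have hterm : (fun n : ℕ => f (lam⁻¹ * (((n + 1 : ℕ) : ℝ) * u))) =
      fun n : ℕ => f (((n + 1 : ℕ) : ℝ) * (lam⁻¹ * u)) := by
    funext n; ring_nf
  have hne : Real.sqrt lam ≠ 0 := (Real.sqrt_pos.2 hlam).ne'
  rw [hterm, hs, ← mul_assoc, ← mul_assoc, mul_inv_cancel₀ hne, one_mul]

/-- The space `𝒮^ev_0` of real-valued even Schwartz functions `f` with `f(0) = 0 = ∫ f(x) dx`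
(Connes–Consani 2023, §6.1, p0018:L20), as a real subspace of `𝓢(ℝ, ℝ)`.
[cite: ConnesConsani2023, §6.1 (arXiv chunk p0018:L20)] -/
def schwartzEv0 : Submodule ℝ 𝓢(ℝ, ℝ) where
  carrier := {f | (∀ x, f (-x) = f x) ∧ f 0 = 0 ∧ ∫ x, f x = 0}
  zero_mem' := by
    refine ⟨fun x => by simp, by simp, by simp⟩
  add_mem' := by
    rintro f g ⟨hfe, hf0, hfi⟩ ⟨hge, hg0, hgi⟩
    refine ⟨fun x => ?_, ?_, ?_⟩
    · show f (-x) + g (-x) = f x + g x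
      rw [hfe, hge]
    · show f 0 + g 0 = 0
      rw [hf0, hg0, add_zero]
    · have h : (fun x => (f + g) x) = fun x => f x + g x := rfl
      rw [h, integral_add f.integrable g.integrable, hfi, hgi, add_zero]
  smul_mem' := by
    rintro c f ⟨hfe, hf0, hfi⟩
    refine ⟨fun x => ?_, ?_, ?_⟩
    · show c • f (-x) = c • f x
      rw [hfe]
    · show c • f 0 = 0
      rw [hf0, smul_zero]
    · have h : (fun x => (c • f) x) = fun x => c • f x := rfl
      rw [h, integral_smul, hfi, smul_zero]

/-- Membership in `𝒮^ev_0` unfolds to: even, `f 0 = 0`, `∫ f = 0`. [cite: ConnesConsani2023, §6.1 (arXiv chunk p0018:L20)] -/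
theorem mem_schwartzEv0_iff (f : 𝓢(ℝ, ℝ)) :
    f ∈ schwartzEv0 ↔ (∀ x, f (-x) = f x) ∧ f 0 = 0 ∧ ∫ x, f x = 0 :=
  Iff.rfl

/-- The scaling action `ϑ(λ)`, `λ ≠ 0`, on Schwartz functions: `(schwartzScale hλ f)(x) = f(λ⁻¹ x)`
(composition with the dilation `x ↦ λ⁻¹ x`, Mathlib `SchwartzMap.compCLMOfContinuousLinearEquiv`; the
dilation is the map called `invDilation` in `Literature.Analysis.Distribution.KernelScaling`).
[cite: ConnesConsani2023, §6.1 (arXiv chunk p0018:L60)] -/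
def schwartzScale {lam : ℝ} (hlam : lam ≠ 0) : 𝓢(ℝ, ℝ) →L[ℝ] 𝓢(ℝ, ℝ) :=
  SchwartzMap.compCLMOfContinuousLinearEquiv ℝ
    (ContinuousLinearEquiv.smulLeft ((Units.mk0 lam hlam)⁻¹ : ℝˣ) : ℝ ≃L[ℝ] ℝ)

/-- Pointwise formula: `schwartzScale hλ f x = f (λ⁻¹ x) = scaleAct λ f x`. [cite: ConnesConsani2023, §6.1 (arXiv chunk p0018:L60)] -/
@[simp] theorem schwartzScale_apply {lam : ℝ} (hlam : lam ≠ 0) (f : 𝓢(ℝ, ℝ)) (x : ℝ) :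
    schwartzScale hlam f x = f (lam⁻¹ * x) := by
  simp only [schwartzScale, SchwartzMap.compCLMOfContinuousLinearEquiv_apply, Function.comp_apply,
    ContinuousLinearEquiv.smulLeft_apply_apply, Units.smul_def, Units.val_inv_eq_inv_val, Units.val_mk0,
    smul_eq_mul]

/-- **Lemma 6.2 (i), first clause: `𝒮^ev_0` is globally invariant under the scaling action** (p0018:L63,
proof p0018:L71: the three defining conditions are scale invariant; `∫ f(λ⁻¹x) dx = |λ| ∫ f = 0`).
[cite: ConnesConsani2023, Lemma 6.2 (i) (arXiv chunk p0018:L63)] -/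
theorem schwartzScale_mem_schwartzEv0 {lam : ℝ} (hlam : lam ≠ 0) {f : 𝓢(ℝ, ℝ)} (hf : f ∈ schwartzEv0) :
    schwartzScale hlam f ∈ schwartzEv0 := by
  obtain ⟨hfe, hf0, hfi⟩ := hf
  refine ⟨fun x => ?_, ?_, ?_⟩
  · simp only [schwartzScale_apply, mul_neg, hfe]
  · simp only [schwartzScale_apply, mul_zero, hf0]
  · have h : (fun x => schwartzScale hlam f x) = fun x => (fun y => f y) (lam⁻¹ * x) := by
      funext x; exact schwartzScale_apply hlam f x
    rw [h, Measure.integral_comp_mul_left (fun y => f y) lam⁻¹, hfi, smul_zero]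

/-! ### The circle `C_μ = ℝ₊^*/μ^ℤ` and the function `Σ_μ 𝓔(f)` on it -/

/-- The real function `x ↦ (Σ_μ 𝓔 f)(eˣ)`, `μ = e^L`: the scale-invariant Riemann sum of `f` read on the
line `u = eˣ` (Connes–Consani 2023, §6.1, the map `Σ_μ 𝓔`, p0018:L3–L18; `𝓔 = connesE`).
[cite: ConnesConsani2023, §6.1 (arXiv chunk p0018:L10–L18)] -/
def sigmaEReal (L : ℝ) (f : ℝ → ℝ) (x : ℝ) : ℝ :=
  scaleSum (Real.exp L) (connesE f) (Real.exp x)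

/-- `x ↦ (Σ_μ 𝓔 f)(eˣ)` is `L`-periodic (`μ = e^L`): this is the scale invariance of `Σ_μ`.
[cite: ConnesConsani2023, §6.1 (arXiv chunk p0018:L10)] -/
theorem sigmaEReal_periodic (L : ℝ) (f : ℝ → ℝ) : Function.Periodic (sigmaEReal L f) L := by
  intro x
  simp only [sigmaEReal, Real.exp_add, mul_comm (Real.exp x) (Real.exp L)]
  exact scaleSum_mul_self (Real.exp_pos L).ne' _ _

/-- The function `Σ_μ 𝓔(f)` on the circle `C_μ = ℝ₊^*/μ^ℤ` of length `L = log μ` (p0019:L1), modelled as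
the complex-valued function on `AddCircle L` obtained from the `L`-periodic `x ↦ (Σ_μ 𝓔 f)(eˣ)`.
[cite: ConnesConsani2023, §6.1–6.2 (arXiv chunks p0018:L10–L18, p0019:L1)] -/
def sigmaE (L : ℝ) (f : ℝ → ℝ) : AddCircle L → ℂ :=
  fun x => ((sigmaEReal_periodic L f).lift x : ℂ)

/-- On representatives: `sigmaE L f ↑x = Σ_{k ∈ ℤ} 𝓔(f)((e^L)^k eˣ)`. [cite: ConnesConsani2023, §6.1 (arXiv chunk p0018:L10–L18)] -/
theorem sigmaE_coe (L : ℝ) (f : ℝ → ℝ) (x : ℝ) :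
    sigmaE L f (x : AddCircle L) = ((scaleSum (Real.exp L) (connesE f) (Real.exp x) : ℝ) : ℂ) := by
  simp only [sigmaE, Function.Periodic.lift_coe, sigmaEReal]

/-- **Lemma 6.2 (i), display (ϑ Σ_μ 𝓔) read on the circle**: for `λ > 0` and every `f`,
`Σ_μ 𝓔(ϑ(λ) f) = λ^{1/2} · (Σ_μ 𝓔 f)(· − log λ)` on `C_μ` (from `𝓔 ∘ λ^{-1/2}ϑ(λ) = ϑ(λ) ∘ 𝓔` and
`ϑ(λ)Σ_μ = Σ_μϑ(λ)`, p0018:L66–L77; additively `ϑ(λ)` is the rotation by `log λ`).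
[cite: ConnesConsani2023, Lemma 6.2 (i) (arXiv chunk p0018:L66–L77)] -/
theorem sigmaE_scaleAct {lam : ℝ} (hlam : 0 < lam) (L : ℝ) (f : ℝ → ℝ) (x : ℝ) :
    sigmaE L (scaleAct lam f) (x : AddCircle L) =
      (Real.sqrt lam : ℂ) * sigmaE L f ((x - Real.log lam : ℝ) : AddCircle L) := by
  rw [sigmaE_coe, sigmaE_coe]
  have h1 : (fun u => connesE (scaleAct lam f) u) = fun u => Real.sqrt lam * scaleAct lam (connesE f) u :=
    funext (connesE_scaleAct hlam f)
  have h2 : scaleSum (Real.exp L) (connesE (scaleAct lam f)) (Real.exp x) =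
      Real.sqrt lam * scaleSum (Real.exp L) (scaleAct lam (connesE f)) (Real.exp x) := by
    rw [show connesE (scaleAct lam f) = fun u => connesE (scaleAct lam f) u from rfl, h1]
    simp only [scaleSum, tsum_mul_left]
  rw [h2, scaleSum_scaleAct, scaleAct, Real.exp_sub, Real.exp_log hlam, div_eq_inv_mul]
  push_cast
  ring

/-- The same for Schwartz functions: `sigmaE L (schwartzScale _ f) ↑x = λ^{1/2} sigmaE L f ↑(x − log λ)`.
[cite: ConnesConsani2023, Lemma 6.2 (i) (arXiv chunk p0018:L66–L77)] -/
theorem sigmaE_schwartzScale {lam : ℝ} (hlam : 0 < lam) (L : ℝ) (f : 𝓢(ℝ, ℝ)) (x : ℝ) :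
    sigmaE L (schwartzScale hlam.ne' f) (x : AddCircle L) =
      (Real.sqrt lam : ℂ) * sigmaE L f ((x - Real.log lam : ℝ) : AddCircle L) := by
  have h : (⇑(schwartzScale hlam.ne' f) : ℝ → ℝ) = scaleAct lam f := by
    funext y; simp only [schwartzScale_apply, scaleAct]
  rw [h, sigmaE_scaleAct hlam]

/-! ### §6.2  ζ-cycles: the subspace `Σ_μ 𝓔(𝒮^ev_0) ⊂ L²(C)`, Definition 6.1, `𝓗(L)`, the spectrum -/

section Circle

variable (L : ℝ) [hL : Fact (0 < L)]

/-- The classes in `L²(C)` (`C` the circle of length `L`, Haar probability measure) of the functions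
`Σ_μ 𝓔(f)`, `f ∈ 𝒮^ev_0` (Connes–Consani 2023, §6.1 "`Σ_μ 𝓔 : 𝒮^ev_0 → L²(C)`", p0018:L3; by Lemma 6.1 (ii)
each `Σ_μ 𝓔(f)` is bounded measurable, hence square integrable — that lemma is the named fact
`CC2023_lemma_6_1`, so membership is phrased by a.e. equality and needs no proof here).
[cite: ConnesConsani2023, §6.1–6.2 (arXiv chunks p0018:L3, p0019:L5)] -/
def zetaCycleGenerators : Set (Lp ℂ 2 (@haarAddCircle L hL)) :=
  {ξ | ∃ f ∈ schwartzEv0, (ξ : AddCircle L → ℂ) =ᵐ[haarAddCircle] sigmaE L f}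

/-- The subspace `Σ_μ 𝓔(𝒮^ev_0) ⊂ L²(C)` (its complex span; see the module docstring), `L = log μ`.
[cite: ConnesConsani2023, Definition 6.1 (arXiv chunk p0019:L5)] -/
def zetaCycleRange : Submodule ℂ (Lp ℂ 2 (@haarAddCircle L hL)) :=
  Submodule.span ℂ (zetaCycleGenerators L)

/-- **Definition 6.1 (ζ-cycle)** (= Definition 1.1): "A ζ-cycle is a circle `C` of length `L = log μ`
such that the subspace `Σ_μ 𝓔(𝒮^ev_0)` is not dense in the Hilbert space `L²(C)`."
[cite: ConnesConsani2023, Definition 6.1 (arXiv chunk p0019:L5); Definition 1.1 (p0002:L20)] -/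
def IsZetaCycle : Prop :=
  (zetaCycleRange L).topologicalClosure ≠ ⊤

/-- The Hilbert space `𝓗(L) := Σ_μ 𝓔(𝒮^ev_0)^⊥ ⊂ L²(C)` (Connes–Consani 2023, §6.2, p0020:L3), on which
`ℝ₊^*` acts through `C_μ`. [cite: ConnesConsani2023, §6.2 (arXiv chunk p0020:L3)] -/
def zetaCycleSpace : Submodule ℂ (Lp ℂ 2 (@haarAddCircle L hL)) :=
  (zetaCycleRange L)ᗮ

/-- A circle is a ζ-cycle iff `𝓗(L) ≠ {0}` (closure of a subspace is everything iff its orthogonal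
complement is trivial). [cite: ConnesConsani2023, Definition 6.1 and §6.2 (arXiv chunks p0019:L5, p0020:L3)] -/
theorem isZetaCycle_iff_zetaCycleSpace_ne_bot : IsZetaCycle L ↔ zetaCycleSpace L ≠ ⊥ :=
  not_congr (Submodule.topologicalClosure_eq_top_iff)

/-- The rotation of the circle by `a`, acting on `L²(C)`: `(rotateLp L a ξ)(x) = ξ(x − a)` a.e.; for
`a = log λ` this is the scaling action `(ϑ(λ)ξ)(u) = ξ(λ⁻¹u)` of `ℝ₊^*` on `L²(C_μ)` (p0018:L60, L69), a
linear isometry (Haar measure is translation invariant).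
[cite: ConnesConsani2023, Lemma 6.2 (ii) (arXiv chunk p0018:L69)] -/
def rotateLp (a : AddCircle L) : Lp ℂ 2 (@haarAddCircle L hL) →ₗᵢ[ℂ] Lp ℂ 2 (@haarAddCircle L hL) :=
  Lp.compMeasurePreservingₗᵢ ℂ (fun x : AddCircle L => -a + x) (measurePreserving_add_left haarAddCircle (-a))

/-- **The spectrum of the action of `ℝ₊^*` on `𝓗(L)`** (Theorem 6.4): the set of `s ∈ ℝ` with
`μ^{is} = 1` (i.e. `sL = 2πn`, `n ∈ ℤ`) whose character `u ↦ u^{is}` of `C_μ` — additively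
`x ↦ e^{isx} = e^{2πinx/L}`, Mathlib's `fourier n`, as the `L²` class `fourierLp 2 n` — lies in `𝓗(L)`
(see the module docstring for why this is the spectrum of the periodic action, p0019:L18, and for the
symmetry `s ↦ −s`). [cite: ConnesConsani2023, Theorem 6.4 and its proof (arXiv chunk p0019:L16–L22)] -/
def zetaCycleSpectrum : Set ℝ :=
  {s | ∃ n : ℤ, s * L = 2 * Real.pi * n ∧ (fourierLp 2 n : Lp ℂ 2 (@haarAddCircle L hL)) ∈ zetaCycleSpace L}

end Circle

/-! ### Lemma 6.1 and Lemma 6.2 (ii), (iii) — named facts -/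

/-- The hypotheses of **Lemma 6.1** on `f : (0, ∞) → ℝ` (p0018:L23): "of bounded variation on `(0,∞)`,
of rapid decay for `u → ∞`, `O(u²)` when `u → 0`, and such that `∫_0^∞ f(t) dt = 0`".  The field
`integrable` is implied by the other three (a function of bounded variation on `(0,∞)` is bounded and
measurable) and is recorded only so that `integral_zero` is not a junk `0` of the Bochner integral.
[cite: ConnesConsani2023, Lemma 6.1 (arXiv chunk p0018:L23)] -/
structure RiemannSumHyp (f : ℝ → ℝ) : Prop where
  bv : BoundedVariationOn f (Ioi 0)
  decay : ∀ N : ℕ, f =O[atTop] fun u => u ^ (-(N : ℝ))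
  nearZero : f =O[𝓝[>] 0] fun u => u ^ 2
  integrable : IntegrableOn f (Ioi 0)
  integral_zero : ∫ u in Ioi 0, f u = 0

/-- **Lemma 6.1** (Connes–Consani 2023, p0018:L23–L24).  Let `f` satisfy `RiemannSumHyp f`.  Then
(i) `𝓔(f)(u) = u^{1/2} Σ_{n>0} f(nu)` is well defined pointwise (the series converges for every `u > 0`),
is `O(u^{1/2})` when `u → 0` and of rapid decay for `u → ∞`;
(ii) for `μ = e^L > 1` the series `Σ_{k ∈ ℤ} 𝓔(f)(μ^k u)` defining `Σ_μ 𝓔(f)` converges (in print: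
geometrically, uniformly for `u` in a period) and `Σ_μ 𝓔(f)` is a bounded measurable function on
`ℝ₊^*/μ^ℤ`.  RH-FREE. [cite: ConnesConsani2023, Lemma 6.1 (arXiv chunk p0018:L23–L24)] -/
def CC2023_lemma_6_1 : Prop :=
  ∀ f : ℝ → ℝ, RiemannSumHyp f →
    ((∀ u : ℝ, 0 < u → Summable fun n : ℕ => f (((n + 1 : ℕ) : ℝ) * u)) ∧
      (connesE f =O[𝓝[>] 0] fun u => Real.sqrt u) ∧
      (∀ N : ℕ, connesE f =O[atTop] fun u => u ^ (-(N : ℝ)))) ∧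
    (∀ L : ℝ, 0 < L →
      (∀ u : ℝ, 0 < u → Summable fun k : ℤ => connesE f (Real.exp L ^ k * u)) ∧
      (∃ C : ℝ, ∀ u : ℝ, 0 < u → |scaleSum (Real.exp L) (connesE f) u| ≤ C) ∧
      Measurable (sigmaE L f))

/-- **Lemma 6.2 (ii)** (p0018:L69): the scaling action `ϑ` induces an action of `C_μ = ℝ₊^*/μ^ℤ` on
`Σ_μ 𝓔(𝒮^ev_0)`: the subspace is invariant under every rotation of the circle (by (i):
`ϑ(λ) Σ_μ 𝓔(f) = λ^{-1/2} Σ_μ 𝓔(ϑ(λ) f)` and `ϑ(λ) 𝒮^ev_0 = 𝒮^ev_0`).  RH-FREE.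
[cite: ConnesConsani2023, Lemma 6.2 (ii) (arXiv chunk p0018:L69)] -/
def CC2023_lemma_6_2_ii : Prop :=
  ∀ (L : ℝ) [Fact (0 < L)] (a : AddCircle L),
    (zetaCycleRange L).map (rotateLp L a).toLinearMap = zetaCycleRange L

/-- **Lemma 6.2 (iii)** (p0018:L69): "Let `f` be a function as in Lemma 6.1 that coincides near zero with a
smooth even function, then `Σ_μ 𝓔(f)` belongs to the closure of `Σ_μ 𝓔(𝒮^ev_0)` in `L²(C_μ)`."  RH-FREE.
[cite: ConnesConsani2023, Lemma 6.2 (iii) (arXiv chunk p0018:L69)] -/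
def CC2023_lemma_6_2_iii : Prop :=
  ∀ (L : ℝ) [Fact (0 < L)] (f : ℝ → ℝ), RiemannSumHyp f →
    (∃ g : ℝ → ℝ, ContDiff ℝ (⊤ : ℕ∞) g ∧ (∀ x, g (-x) = g x) ∧ ∀ᶠ u in 𝓝[>] (0 : ℝ), f u = g u) →
    ∃ ξ ∈ (zetaCycleRange L).topologicalClosure,
      (ξ : AddCircle L → ℂ) =ᵐ[haarAddCircle] sigmaE L f

/-! ### Proposition 6.3 — stability under finite covers (named fact) -/

/-- **Proposition 6.3** (p0019:L9): "Let `C` be a ζ-cycle of length `L = log μ`, then for any positive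
integer `n > 0` the `n`-fold cover of `C` is a ζ-cycle", i.e. the circle of length `nL` is a ζ-cycle
(proof: pull back an orthogonal vector along the cover, p0019:L11–L12).  RH-FREE.
[cite: ConnesConsani2023, Proposition 6.3 (arXiv chunk p0019:L9–L12)] -/
def CC2023_prop_6_3 : Prop :=
  ∀ (L L' : ℝ) [Fact (0 < L)] [Fact (0 < L')] (n : ℕ), 0 < n → L' = n * L →
    IsZetaCycle L → IsZetaCycle L'

/-! ### Theorem 6.4 (= Theorem 1.1) and its two inputs — named facts -/

/-- **Equation (𝓔 ζ) of the proof of Theorem 6.4** (display (𝓔 ζ)/"(mapEzeta)", p0019:L68, with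
L52–L89): for `f ∈ 𝒮^ev_0`, `∫_0^∞ 𝓔(f)(u) u^{-iz} d^*u = ζ(½ − iz) ψ(z)`,
`ψ(z) = ∫_0^∞ f(u) u^{½ − iz} d^*u`, proved by Fubini for `Im z > ½` and extended to `Im z > −½` (in
particular to `z ∈ ℝ`) by analytic continuation, the pole of `ζ` at `z = i/2` being cancelled by
`ψ(i/2) = ∫_0^∞ f = 0`.  In Mellin notation (`s = −iz`, Mathlib's `mellin g s = ∫_0^∞ g(u) u^{s-1} du`):
for `Re s > −½`, `s ≠ ½`, the Mellin transform of `𝓔(f)` converges absolutely at `s` and equals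
`ζ(s + ½) · mellin f (s + ½)` — the shape of the tree's `mellin_connesE_of_integral_eq_zero`
(Lipschitz compactly supported data), here for the Schwartz class `𝒮^ev_0`.  (At `s = ½` the identity is
not asserted: Mathlib's `ζ(1)` is a junk value.)  RH-FREE.
[cite: ConnesConsani2023, proof of Theorem 6.4, eq. (𝓔 ζ) (arXiv chunk p0019:L52–L89)] -/
def CC2023_mapEzeta : Prop :=
  ∀ f ∈ schwartzEv0, ∀ s : ℂ, -(1 / 2 : ℝ) < s.re → s ≠ 1 / 2 →
    MellinConvergent (fun u => (connesE f u : ℂ)) s ∧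
      mellin (fun u => (connesE f u : ℂ)) s =
        riemannZeta (s + 1 / 2) * mellin (fun x => ((f x : ℝ) : ℂ)) (s + 1 / 2)

/-- The test function of the proof of Theorem 6.4 (i): `f(x) := e^{-πx²} πx² (−2πx² + 3)` (p0019:L30).
[cite: ConnesConsani2023, proof of Theorem 6.4 (i) (arXiv chunk p0019:L30)] -/
def gaussWitness (x : ℝ) : ℝ :=
  Real.exp (-Real.pi * x ^ 2) * (Real.pi * x ^ 2) * (-2 * Real.pi * x ^ 2 + 3)

/-- "One easily checks that `∫_0^∞ f(x) dx = 0` and that `f ∈ 𝒮^ev_0`" for `f = gaussWitness`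
(p0019:L30): there is a (real-valued) Schwartz function with these values, and it lies in `𝒮^ev_0`.
RH-FREE. [cite: ConnesConsani2023, proof of Theorem 6.4 (i) (arXiv chunk p0019:L30)] -/
def CC2023_gaussWitness_mem : Prop :=
  ∃ F : 𝓢(ℝ, ℝ), (∀ x, F x = gaussWitness x) ∧ F ∈ schwartzEv0

/-- The Mellin transform of the test function (the computation behind the displays p0019:L33 and L44):
for `Re w > 0`, `∫_0^∞ f(x) x^{w-1} dx = ((1 − w)/2) · π^{−w/2} · Γ(w/2 + 1)`
`= (w(1−w)/4) π^{−w/2} Γ(w/2)` (from `∫_0^∞ x^{w-1} e^{-πx²} dx = ½ π^{-w/2} Γ(w/2)` and the shifts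
`w ↦ w + 2, w + 4`).  At `w = ½ + is`, `s` real, this is `¼ (¼ + s²) π^{−¼−is/2} Γ(¼ + is/2) ≠ 0`, which is
what the proof uses ("thus `½ + is` is a zero of zeta", p0019:L46); the display p0019:L33 prints this
value with the weight `u^{1/2}` of `w(f)(x) = x^{1/2} f(x)` (p0019:L52) left implicit and without the
constant factor `¼` — immaterial for the argument.  At `w = 1` it gives `∫_0^∞ f = 0`.  RH-FREE.
[cite: ConnesConsani2023, proof of Theorem 6.4 (i) (arXiv chunk p0019:L30–L46)] -/
def CC2023_mellin_gaussWitness : Prop :=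
  ∀ w : ℂ, 0 < w.re →
    mellin (fun x => ((gaussWitness x : ℝ) : ℂ)) w =
      (1 - w) / 2 * (Real.pi : ℂ) ^ (-w / 2) * Complex.Gamma (w / 2 + 1)

/-- **Theorem 6.4 (i)** (= Theorem 1.1 (i); p0019:L16, p0002:L25): "Let `C` be a ζ-cycle.  Then the
spectrum of the action of the multiplicative group `ℝ₊^*` on the orthogonal complement of
`Σ_μ 𝓔(𝒮^ev_0)` in `L²(C)` is formed by imaginary parts of zeros of zeta on the critical line":
every `s ∈ zetaCycleSpectrum L` has `ζ(½ + is) = 0`.  (The hypothesis "`C` is a ζ-cycle" only makes the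
spectrum non-empty; the implication is stated for every circle.)  RH-FREE: a statement about zeros ON
the critical line; nothing here bears on the truth of RH.
[cite: ConnesConsani2023, Theorem 6.4 (i) (arXiv chunk p0019:L16–L46); Theorem 1.1 (i) (p0002:L25)] -/
def CC2023_thm_6_4_i : Prop :=
  ∀ (L : ℝ) [Fact (0 < L)], ∀ s ∈ zetaCycleSpectrum L, riemannZeta (1 / 2 + s * I) = 0

/-- **Theorem 6.4 (ii)** (= Theorem 1.1 (ii); p0019:L16, p0002:L25): "Let `s > 0` be such that
`ζ(½ + is) = 0`, then any circle `C` of length an integral multiple of `2π/s` (`L = 2πn/s`, i.e.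
`sL = 2πn`, `n ≥ 1`) is a ζ-cycle and its spectrum (for the action of `ℝ₊^*`) contains `s`."  RH-FREE;
nothing here bears on the truth of RH.
[cite: ConnesConsani2023, Theorem 6.4 (ii) (arXiv chunk p0019:L16, proof L46–p0020:L1); Theorem 1.1 (ii) (p0002:L25)] -/
def CC2023_thm_6_4_ii : Prop :=
  ∀ (L : ℝ) [Fact (0 < L)] (s : ℝ) (n : ℕ), 0 < s → 0 < n → riemannZeta (1 / 2 + s * I) = 0 →
    s * L = 2 * Real.pi * n → IsZetaCycle L ∧ s ∈ zetaCycleSpectrum L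

/-- **Corollary 6.5** (p0020:L5–L9): with `Z` the set of imaginary parts of the zeros of `ζ` on the critical
line, `𝓗(L) ≠ {0} ↔ ∃ s ∈ Z, n ∈ ℤ, sL = 2πn`.  Typed exactly as printed (`s` of either sign, `s = 0`
allowed: the tree does not know `ζ(½) ≠ 0`, and the equivalence as stated does not need it).  RH-FREE;
nothing here bears on the truth of RH. [cite: ConnesConsani2023, Corollary 6.5 (arXiv chunk p0020:L5–L12)] -/
def CC2023_cor_6_5 : Prop :=
  ∀ (L : ℝ) [Fact (0 < L)],
    zetaCycleSpace L ≠ ⊥ ↔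
      ∃ s : ℝ, riemannZeta (1 / 2 + s * I) = 0 ∧ ∃ n : ℤ, s * L = 2 * Real.pi * n

end Literature.NumberTheory.ConnesConsani2023.ZetaCycles
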